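import Summits.QuantumFields.YangMills.Theorems.BalabanUVNodesN15KingModelAnalyticBlockCovZeroMode
import Literature.LinearAlgebra.Matrix.RayleighQuotient
import HarnessLib

/-!
# BalabanUVNodes ∕ N15 — THE KING-MODEL RUNG (PART Ϫ-l): THE SHARP REAL-SLICE SANDWICH OF KING's EFFECTIVE LAPLACIAN AT EVERY BACKGROUND — `am²∕(a+m²) ≤ Δ_eff(U) ≤ a` —
# PART Ϥ-k's form sandwich `a⁻¹ ≤ (Δ_eff(U))⁻¹ ≤ a⁻¹ + m⁻²` (every unitary `U`, no window, no curvature hypothesis) INVERTED through the eigenvector basis of the Hermitian block-field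
# covariance ([HornJohnson2013] Thm 4.2.2 (c), tree `RayleighQuotient`): every eigenvalue of `Δ_eff(U)` lies in `[(a⁻¹+m⁻²)⁻¹, a]`, hence ★★★★ `(a⁻¹+m⁻²)⁻¹‖g‖² ≤ ⟨g,Δ_eff(U)g⟩ ≤ a‖g‖²`
# uniformly in `U`, `L`, the volume, the fibre and the contour system — the lower constant is the series mass `am²∕(a+m²)`, ATTAINED on the zero mode at `U ≡ 1` (PART Ϫ-j), and it
# supersedes PART Ϫ-h's crude `β₁`; door (t4⁵⁸) of §g52 closed
# (Track A, DAG node N15 = NE2; FAN-OUT v1.1 §N15 s3 «KING-MODEL RUNG … + what the curved case adds»; count-neutral)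

HONEST FRAMING.  Count-neutral (cell `pub-ymgap`, seat `pub-ymgap-dag-n15-e` g52; `--supports stmt-QuantumFields-27247 --as helper` = K3ᴬ, KEY MAP v3).  King's one-level comparison model at
UNITARY backgrounds (the real slice), massive fine covariance `m² > 0`, `a > 0`, `c ≥ 0`, nonempty fibre; spectral theory of Hermitian matrices (Mathlib's eigenvector basis through the tree's
Rayleigh-quotient file).  NOT the complex window (there `Δ_eff(U,U⁻¹)` is not Hermitian; PART Ϫ-f's accretivity constant `β₁` is what survives); NOT Bałaban's multi-level objects; NOT a node
discharge (N15 of record untouched); nothing continuum ∕ ℝ⁴ ∕ OS ∕ Clay.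

THE RESULTS (every unitary `U`, `a, m² > 0`, `c ≥ 0`, nonempty fibre, any tree contour system, any volume):
* §1 `isHermitian_effLapU` (`Δ_eff(U)` is Hermitian), `effLapU_mul_inv_effLapU` ∕ `inv_effLapU_mul_effLapU`, ★★ `eigenvalue_effLapU_pos_and_inv_le` (an eigenpair `Δ_eff(U)v = μv`, `v ≠ 0` has
  `0 < μ`, `μ⁻¹ ≤ a⁻¹ + m⁻²`, `a⁻¹ ≤ μ⁻¹`), ★★★ **`eigenvalues_effLapU_mem_Icc`** (every eigenvalue of `Δ_eff(U)` lies in `[(a⁻¹+m⁻²)⁻¹, a]`).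
* §2 ★★★★ **`re_quadForm_effLapU_ge_sharp`** (`(a⁻¹+m⁻²)⁻¹·Σ‖g‖² ≤ Re⟨g,Δ_eff(U)g⟩` — THE SERIES MASS `am²∕(a+m²)` BOUNDS KING's EFFECTIVE LAPLACIAN BELOW AT EVERY CURVED BACKGROUND),
  ★★★ **`re_quadForm_effLapU_le_coupling`** (`Re⟨g,Δ_eff(U)g⟩ ≤ a·Σ‖g‖²`), ★★★★ **`king_effLap_real_slice_sandwich`** (both, in `‖toLp g‖²` currency), ★★ `sharp_floor_attained_at_one` (PART Ϫ-j:
  equality on the zero mode at `U ≡ 1`). (PART Ϫ-j's `floor_le_zeroMode_mass` gives `β₁ ≤ (a⁻¹+m⁻²)⁻¹` by name.)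
PRIOR TREE ART (by name): Ϥ-k (`effLapU`, `isUnit_effLapU`, `re_quadForm_effLapU_inv_ge`, `re_quadForm_effLapU_inv_le`), Ϫ-a (`cxEffLap_adjoint`, `isHermitian_cxBlockCov_adjoint`, `cxBlockCov_adjoint_eq_inv_effLapU`),
Ϫ-j (`re_quadForm_effLapU_one_const`, `floor_le_zeroMode_mass`), Literature `RayleighQuotient` (`inf_mul_le_re_form`, `re_form_le_sup_mul`, `mulVec_eigenvectorBasis_eq_coe_smul`, `sum_norm_sq_eigenvectorBasis`,
`re_form_eq_mul_of_mulVec_eq_smul`, `re_star_dotProduct_self`), Mathlib (`Matrix.IsHermitian.inv`, `Finset.le_inf'`, `Finset.sup'_le`).  Dedup (rg at filing): basename 0 files; needles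
`isHermitian_effLapU|eigenvalues_effLapU_mem_Icc|re_quadForm_effLapU_ge_sharp|king_effLap_real_slice_sandwich` 0 tree files.  Locators: [King1986] (2.14) p.653, (4.33) p.674, (4.44) p.675;
[Balaban1985BackgroundPropagators] (3.25) p.394; [HornJohnson2013] Thm 4.2.2 (c) p.234.  0 `sorry`, 0 `def`.
-/

noncomputable section
open scoped BigOperators ComplexConjugate ComplexOrder Matrix.Norms.L2Operator
open Finset Matrix WithLp

namespace Summit.QuantumFields.YangMills.BalabanUVNodes.N15KingModelRung.Analytic

open Literature.MathematicalPhysics.QuantumFieldTheory.Balaban1983to89.B5Prop11Plancherel (Tor fine)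
open Literature.LinearAlgebra.Matrix.RayleighQuotient (inf_mul_le_re_form re_form_le_sup_mul mulVec_eigenvectorBasis_eq_coe_smul sum_norm_sq_eigenvectorBasis re_star_dotProduct_self)
open Summit.QuantumFields.YangMills.BalabanUVNodes.N15KingModelRung.CovariantBlock (BlockTree effLapU isUnit_effLapU re_quadForm_effLapU_inv_ge re_quadForm_effLapU_inv_le)

variable {d : ℕ} {L : ℕ} [NeZero L] (T : BlockTree d L) (M : Fin (d + 1) → ℕ) [hM : ∀ μ, NeZero (M μ)]
variable {𝕜 : Type*} [RCLike 𝕜] {n : Type*} [Fintype n] [DecidableEq n]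

/-! ## §1 `Δ_eff(U)` is Hermitian; its eigenvalues lie in `[(a⁻¹+m⁻²)⁻¹, a]` -/

section Spectrum

variable {a c m2 : ℝ} (ha : 0 < a) (hc : 0 ≤ c) (hm : 0 < m2) {U : Tor (fine L M) × Fin (d + 1) → Matrix n n 𝕜} (hU : ∀ bd, U bd ∈ Matrix.unitaryGroup n 𝕜)
include ha hc hm hU

/-- KING's EFFECTIVE LAPLACIAN IS HERMITIAN at every unitary background (inverse of the Hermitian block-field covariance `C(U,Uᴴ)`, PART Ϫ-a). [cite: King1986, (2.14) p.653] -/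
theorem isHermitian_effLapU : (effLapU T M a c m2 U).IsHermitian := by
  have h := (isHermitian_cxBlockCov_adjoint T M a c m2 U).inv
  rwa [cxBlockCov_adjoint_eq_inv_effLapU T M ha hc hm hU, Matrix.nonsing_inv_nonsing_inv _ ((Matrix.isUnit_iff_isUnit_det _).mp (isUnit_effLapU T M ha hc hm hU))] at h

/-- `Δ_eff(U)·(Δ_eff(U))⁻¹ = 1`. [cite: King1986, (2.14) p.653] -/
theorem effLapU_mul_inv_effLapU : effLapU T M a c m2 U * (effLapU T M a c m2 U)⁻¹ = 1 :=
  Matrix.mul_nonsing_inv _ ((Matrix.isUnit_iff_isUnit_det _).mp (isUnit_effLapU T M ha hc hm hU))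

/-- `(Δ_eff(U))⁻¹·Δ_eff(U) = 1`. [cite: King1986, (2.14) p.653] -/
theorem inv_effLapU_mul_effLapU : (effLapU T M a c m2 U)⁻¹ * effLapU T M a c m2 U = 1 :=
  Matrix.nonsing_inv_mul _ ((Matrix.isUnit_iff_isUnit_det _).mp (isUnit_effLapU T M ha hc hm hU))

/-- ★★ **AN EIGENPAIR OF `Δ_eff(U)` READ THROUGH PART Ϥ-k's SANDWICH**: `Δ_eff(U)v = μv`, `v ≠ 0` (real `μ`) ⟹ `0 < μ`, `a⁻¹ ≤ μ⁻¹ ≤ a⁻¹ + m⁻²` — for `(Δ_eff)⁻¹v = μ⁻¹v` and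
`a⁻¹‖v‖² ≤ Re⟨v,(Δ_eff)⁻¹v⟩ ≤ (a⁻¹+m⁻²)‖v‖²`. [cite: King1986, (2.14) p.653, (4.33) p.674, (4.44) p.675; Balaban1985BackgroundPropagators, (3.25) p.394] -/
theorem eigenvalue_effLapU_pos_and_inv_le {μ : ℝ} {v : Tor M × n → 𝕜} (hv : v ≠ 0) (hΔv : effLapU T M a c m2 U *ᵥ v = ((μ : ℝ) : 𝕜) • v) :
    0 < μ ∧ a⁻¹ ≤ μ⁻¹ ∧ μ⁻¹ ≤ a⁻¹ + m2⁻¹ := by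
  set C := (effLapU T M a c m2 U)⁻¹ with hCdef
  have hN : 0 < ‖(toLp 2 v : EuclideanSpace 𝕜 (Tor M × n))‖ ^ 2 := by
    have : (toLp 2 v : EuclideanSpace 𝕜 (Tor M × n)) ≠ 0 := fun h0 => hv (by simpa using congrArg ofLp h0)
    positivity
  have hlo := re_quadForm_effLapU_inv_ge T M ha hc hm hU v
  have hhi := re_quadForm_effLapU_inv_le T M ha hc hm hU v
  -- `C(μ•v) = v`
  have hCv : ((μ : ℝ) : 𝕜) • (C *ᵥ v) = v := by
    have h : C *ᵥ (effLapU T M a c m2 U *ᵥ v) = C *ᵥ (((μ : ℝ) : 𝕜) • v) := by rw [hΔv]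
    rw [Matrix.mulVec_mulVec, hCdef, inv_effLapU_mul_effLapU T M ha hc hm hU, Matrix.one_mulVec, Matrix.mulVec_smul] at h
    exact h.symm
  have hμ0 : μ ≠ 0 := by
    intro h0
    rw [h0] at hCv
    simp only [RCLike.ofReal_zero, zero_smul] at hCv
    exact hv hCv.symm
  have hCv' : C *ᵥ v = ((μ⁻¹ : ℝ) : 𝕜) • v := by
    have h : ((μ⁻¹ : ℝ) : 𝕜) • (((μ : ℝ) : 𝕜) • (C *ᵥ v)) = ((μ⁻¹ : ℝ) : 𝕜) • v := by rw [hCv]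
    rw [smul_smul, show ((μ⁻¹ : ℝ) : 𝕜) * ((μ : ℝ) : 𝕜) = 1 by rw [← RCLike.ofReal_mul, inv_mul_cancel₀ hμ0, RCLike.ofReal_one], one_smul] at h
    exact h
  -- the form on `v`: `Re⟨v,Cv⟩ = μ⁻¹‖v‖²`
  have hform : RCLike.re (star v ⬝ᵥ (C *ᵥ v)) = μ⁻¹ * ‖(toLp 2 v : EuclideanSpace 𝕜 (Tor M × n))‖ ^ 2 := by
    rw [hCv', dotProduct_smul, smul_eq_mul, RCLike.re_ofReal_mul, EuclideanSpace.norm_sq_eq, re_star_dotProduct_self]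
  rw [hform] at hlo hhi
  have h1 : a⁻¹ ≤ μ⁻¹ := le_of_mul_le_mul_right hlo hN
  have h2 : μ⁻¹ ≤ a⁻¹ + m2⁻¹ := le_of_mul_le_mul_right hhi hN
  have hμpos : 0 < μ := by
    have : 0 < μ⁻¹ := lt_of_lt_of_le (inv_pos.2 ha) h1
    exact inv_pos.mp this
  exact ⟨hμpos, h1, h2⟩

/-- ★★★ **THE SPECTRUM OF KING's EFFECTIVE LAPLACIAN AT EVERY UNITARY BACKGROUND**: every eigenvalue lies in `[(a⁻¹+m⁻²)⁻¹, a] = [am²∕(a+m²), a]` — uniformly in `U`, the spacing, the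
volume, the fibre and the contour system. [cite: King1986, (2.14) p.653, (4.33) p.674; Balaban1985BackgroundPropagators, (3.25) p.394; HornJohnson2013, Thm 4.2.2 (c) p.234] -/
theorem eigenvalues_effLapU_mem_Icc (p : Tor M × n) :
    (isHermitian_effLapU T M ha hc hm hU).eigenvalues p ∈ Set.Icc (a⁻¹ + m2⁻¹)⁻¹ a := by
  set hH := isHermitian_effLapU T M ha hc hm hU
  have hv0 : (⇑(hH.eigenvectorBasis p) : Tor M × n → 𝕜) ≠ 0 := by
    intro h0
    have h1 := sum_norm_sq_eigenvectorBasis hH p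
    rw [h0] at h1
    simp at h1
  obtain ⟨hpos, h1, h2⟩ := eigenvalue_effLapU_pos_and_inv_le T M ha hc hm hU hv0 (mulVec_eigenvectorBasis_eq_coe_smul hH p)
  exact ⟨(inv_le_comm₀ (by positivity) hpos).mpr h2, (inv_le_inv₀ ha hpos).mp h1⟩

end Spectrum

/-! ## §2 The sharp form sandwich at every unitary background -/

section Sandwich

variable [Nonempty n] {a c m2 : ℝ} (ha : 0 < a) (hc : 0 ≤ c) (hm : 0 < m2) {U : Tor (fine L M) × Fin (d + 1) → Matrix n n 𝕜} (hU : ∀ bd, U bd ∈ Matrix.unitaryGroup n 𝕜)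
include ha hc hm hU

/-- ★★★★ **THE SERIES MASS BOUNDS KING's EFFECTIVE LAPLACIAN BELOW AT EVERY CURVED BACKGROUND**: `(a⁻¹+m⁻²)⁻¹·Σ‖g‖² ≤ Re⟨g, Δ_eff(U)g⟩` for every unitary `U` and every block field `g` —
sharp (attained on the zero mode at `U ≡ 1`, PART Ϫ-j), uniform in `U`, the spacing, the volume, the fibre and the contour system; it supersedes PART Ϫ-h's crude `β₁`.
[cite: King1986, (2.14) p.653, (4.33) p.674; Balaban1985BackgroundPropagators, (3.25) p.394; HornJohnson2013, Thm 4.2.2 (c) p.234] -/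
theorem re_quadForm_effLapU_ge_sharp (g : Tor M × n → 𝕜) :
    (a⁻¹ + m2⁻¹)⁻¹ * ∑ p, ‖g p‖ ^ 2 ≤ RCLike.re (star g ⬝ᵥ (effLapU T M a c m2 U *ᵥ g)) := by
  have hH := isHermitian_effLapU T M ha hc hm hU
  have h := inf_mul_le_re_form hH g
  have hinf : (a⁻¹ + m2⁻¹)⁻¹ ≤ univ.inf' univ_nonempty hH.eigenvalues := Finset.le_inf' _ _ fun p _ => (eigenvalues_effLapU_mem_Icc T M ha hc hm hU p).1
  exact (mul_le_mul_of_nonneg_right hinf (Finset.sum_nonneg fun _ _ => sq_nonneg _)).trans h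

/-- ★★★ **… AND THE BLOCK COUPLING BOUNDS IT ABOVE**: `Re⟨g, Δ_eff(U)g⟩ ≤ a·Σ‖g‖²` for every unitary `U`. [cite: King1986, (2.14) p.653; Balaban1985BackgroundPropagators, (3.25) p.394; HornJohnson2013, Thm 4.2.2 (c) p.234] -/
theorem re_quadForm_effLapU_le_coupling (g : Tor M × n → 𝕜) :
    RCLike.re (star g ⬝ᵥ (effLapU T M a c m2 U *ᵥ g)) ≤ a * ∑ p, ‖g p‖ ^ 2 := by
  have hH := isHermitian_effLapU T M ha hc hm hU
  have h := re_form_le_sup_mul hH g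
  have hsup : univ.sup' univ_nonempty hH.eigenvalues ≤ a := Finset.sup'_le _ _ fun p _ => (eigenvalues_effLapU_mem_Icc T M ha hc hm hU p).2
  exact h.trans (mul_le_mul_of_nonneg_right hsup (Finset.sum_nonneg fun _ _ => sq_nonneg _))

/-- ★★★★ **THE SHARP REAL-SLICE SANDWICH `am²∕(a+m²) ≤ Δ_eff(U) ≤ a`** in the `ℓ²`-norm currency: for every unitary `U` and every block field `g`,
`(a⁻¹+m⁻²)⁻¹‖g‖² ≤ Re⟨g,Δ_eff(U)g⟩ ≤ a‖g‖²`. [cite: King1986, (2.14) p.653, (4.33) p.674, (4.44) p.675; Balaban1985BackgroundPropagators, (3.25) p.394; HornJohnson2013, Thm 4.2.2 (c) p.234] -/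
theorem king_effLap_real_slice_sandwich (g : Tor M × n → 𝕜) :
    (a⁻¹ + m2⁻¹)⁻¹ * ‖(toLp 2 g : EuclideanSpace 𝕜 (Tor M × n))‖ ^ 2 ≤ RCLike.re (star g ⬝ᵥ (effLapU T M a c m2 U *ᵥ g))
      ∧ RCLike.re (star g ⬝ᵥ (effLapU T M a c m2 U *ᵥ g)) ≤ a * ‖(toLp 2 g : EuclideanSpace 𝕜 (Tor M × n))‖ ^ 2 := by
  rw [EuclideanSpace.norm_sq_eq]
  exact ⟨re_quadForm_effLapU_ge_sharp T M ha hc hm hU g, re_quadForm_effLapU_le_coupling T M ha hc hm hU g⟩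

omit hU in
/-- ★★ **THE FLOOR IS ATTAINED**: at `U ≡ 1` the fibre-constant field realises `Re⟨g,Δ_eff(1)g⟩ = (a⁻¹+m⁻²)⁻¹‖g‖²` (PART Ϫ-j's zero mode) — the constant `am²∕(a+m²)` cannot be improved.
[cite: King1986, (2.14) p.653, (4.33) p.674] -/
theorem sharp_floor_attained_at_one :
    ∃ g : Tor M × n → 𝕜, g ≠ 0 ∧ RCLike.re (star g ⬝ᵥ (effLapU T M a c m2 (fun _ => (1 : Matrix n n 𝕜)) *ᵥ g)) = (a⁻¹ + m2⁻¹)⁻¹ * ‖(toLp 2 g : EuclideanSpace 𝕜 (Tor M × n))‖ ^ 2 := by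
  refine ⟨fun q : Tor M × n => (fun _ : n => (1 : 𝕜)) q.2, ?_, re_quadForm_effLapU_one_const T M ha hc hm (fun _ : n => (1 : 𝕜))⟩
  exact Covariant.const_ne_zero_of_ne_zero M (e := fun _ : n => (1 : 𝕜)) (Function.ne_iff.mpr ⟨Classical.arbitrary n, one_ne_zero⟩)

end Sandwich

end Summit.QuantumFields.YangMills.BalabanUVNodes.N15KingModelRung.Analytic

end
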